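import Mathlib
import Literature.NumberTheory.EllipticCurves.Greenberg1999.ControlLocalKernelsLayer
import Literature.NumberTheory.EllipticCurves.Greenberg1999.EulerCharacteristicNumberFieldAnyPrime
import Literature.NumberTheory.EllipticCurves.QuadraticTwist
import HarnessLib

/-!
# STUB-IDEAS `stub_heegnerIndexLowerAtTwo` — ideator k = 2, gen 12 (FAMILY 1: literature transfer,
# recent-theorem / open-question harvest, typed dictionary)

Crux `SplitBadTwoLowerHalfOfFacts` (stmt-BirchSwinnertonDyer-27851), route `PrintCf2`, stub
`stub_heegnerIndexLowerAtTwo` of the registered skeleton `kside_finite_two` (v3, sha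
`f2bd84c0…`). Companion card: `Ideas/stub_heegnerIndexLowerAtTwo-k2.md` (slug assigned by the gate).

**THE LEVER ("the twist lives in the tower").** Every member `W` of the class is `A ⊗ χ_ε` with
`A = W^{(ε)}` GOOD ORDINARY at `2` and `ε ∈ {2, −1, −2}`. At `p = 2` — and only at `p = 2` — all
three ramified quadratic fields `ℚ₂(√ε)` lie INSIDE the cyclotomic `2`-tower `ℚ₂(μ₈) ⊂ ℚ₂(μ_{2^∞})`
(§A: `(ζ₈ ± ζ₈⁻¹)² = ±2`, `ζ₈⁴ = −1`), and `χ_8` is even a character OF `Γ = Gal(ℚ_cyc/ℚ)`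
(§A: `χ_8(−1) = +1`, `χ_8(5) = −1`; `χ_{−4}`, `χ_{−8}` are odd). Hence, for the INTERNAL type
`ε = 2`, the cyclotomic Selmer module of the ADDITIVE curve `W` over any number field is the
good-ordinary partner's module with the `Λ`-action re-parametrised by the involution
`T ↦ −T − 2` (§B, §D `TwistInTowerTwo`): `f_W(T) ∼ f_A(−T − 2)`, same `λ`, same `μ`
(§B `natDegree_comp_twist`, `map_modTwo_comp_twist`); for the EXTERNAL types the same holds over
the `μ_{2^∞}`-tower up to a `Δ = ℤ/2`-descent whose errors are killed by `2` (§C). Consequently the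
research node K4 = (Desc⁻) of road B⁻ (FALLBACK 1″; and the leading-term node of FALLBACK 1/1′) —
"one-sided Perrin-Riou/Schneider descent for `W/K` at the ADDITIVE prime `2`, inside
`AdditiveIwasawaTheoryAtTwoBarrier`" — is the `χ_ε`-twisted reading of the GOOD-ORDINARY descent:
every TOWER-level input is the partner's and in print at any `p` (tree: `Greenberg1999.*AnyPrime`,
`imKummer_ge_strictCondition_goodOrdinary*`, `finite_torsion_cyclotomicZpExtension`), and the
additive prime survives only as ONE bottom-layer digit `cΓ + cN (+ cΔ)` (§D
`LocalTowerKerTwistedOrdinaryTwo`, §E). This file: PROVED dictionary / algebra shadows (§A–§C, §E)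
and research `Prop`s typed over tree declarations (§D; `def … : Prop`, nothing asserted).

BSD is NOT proved by any of this; the crux and the stub are NOT proved here; §D are conjectural
statements (targets), not facts.
-/

noncomputable section

set_option linter.dupNamespace false

open scoped Classical NumberField

open WeierstrassCurve IsDedekindDomain Literature.NumberTheory.EllipticCurves Polynomial

namespace Summit.BirchSwinnertonDyer.BirchSwinnertonDyer.Cruxes.SplitBadTwoLowerHalfOfFacts.StubIdeasK2G12

/-! ## §A The dictionary at `2` (proved shadows)

`ℤ₂ˣ = {±1} × (1 + 4ℤ₂)` is topologically generated by `−1 ≡ 7 (mod 8)` and `5`; a quadratic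
character `χ_d` (`d ∈ {2, −1, −2}`, conductor `8, 4, 8`) factors through `Γ = ℤ₂ˣ/{±1}` iff
`χ_d(7) = +1`, and is then non-trivial on the topological generator `5` iff `χ_d(5) = −1`.
Kronecker symbols as `jacobiSym d n` (`n` odd). -/

/-- `χ_8` is EVEN: `(2/7) = +1` — `ℚ(√2) ⊂ ℚ_cyc` (first layer `ℚ(ζ₁₆ + ζ₁₆⁻¹) ⊃ ℚ(√2)`). -/
theorem chi8_at_seven : jacobiSym 2 7 = 1 := by norm_num
/-- … and non-trivial on `Γ`: `(2/5) = −1`, so `χ_8(γ) = −1` for every topological generator. -/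
theorem chi8_at_five : jacobiSym 2 5 = -1 := by norm_num
/-- `χ_{−4}` is ODD: `(−1/7) = −1` — `ℚ(i) ⊄ ℚ_cyc` (external type `ε = −1`). -/
theorem chiNeg4_at_seven : jacobiSym (-1) 7 = -1 := by norm_num
theorem chiNeg4_at_five : jacobiSym (-1) 5 = 1 := by norm_num
/-- `χ_{−8}` is ODD: `(−2/7) = −1` — `ℚ(√−2) ⊄ ℚ_cyc` (external type `ε = −2`). -/
theorem chiNeg8_at_seven : jacobiSym (-2) 7 = -1 := by norm_num
theorem chiNeg8_at_five : jacobiSym (-2) 5 = -1 := by norm_num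

/-- **All three ramified quadratic extensions of `ℚ₂` are cyclotomic**: in any field, a primitive
8th root of unity `ζ` gives `√2 = ζ + ζ⁻¹`, `√−2 = ζ − ζ⁻¹`, `√−1 = ζ²`. (At odd `p` only
`ℚ_p(√p*) ⊂ ℚ_p(μ_p)` is cyclotomic, and it is TAME — Delbourgo's `d ∣ p − 1`; at `2` the wild
quadratic semistabilising field is inside the `ℤ₂`-part of the tower.) -/
theorem sqrt_pm_two_and_i_of_isPrimitiveRoot_eight {F : Type*} [Field F] {ζ : F}
    (hζ : IsPrimitiveRoot ζ 8) :
    (ζ + ζ⁻¹) ^ 2 = 2 ∧ (ζ - ζ⁻¹) ^ 2 = -2 ∧ (ζ ^ 2) ^ 2 = -1 := by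
  have h8 : ζ ^ 8 = 1 := hζ.pow_eq_one
  have h4 : ζ ^ 4 = -1 := by
    have hsq : ζ ^ 4 * ζ ^ 4 = 1 := by linear_combination h8
    rcases mul_self_eq_one_iff.mp hsq with h | h
    · exact absurd h (hζ.pow_ne_one_of_pos_of_lt (by norm_num) (by norm_num))
    · exact h
  have hinv : ζ⁻¹ = ζ ^ 7 := inv_eq_of_mul_eq_one_right (by linear_combination h8)
  rw [hinv]
  refine ⟨?_, ?_, ?_⟩
  · linear_combination (2 : F) * h8 + ζ ^ 2 * (ζ ^ 8 - ζ ^ 4 + 1) * h4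
  · linear_combination (-2 : F) * h8 + ζ ^ 2 * (ζ ^ 8 - ζ ^ 4 + 1) * h4
  · linear_combination h4

/-- `CMSplit` at `2`, shadow: `−7 ≡ 1 (mod 8)`, so `√−7 ∈ ℚ₂` (Hensel) and `2` splits in
`K₀ = ℚ(√−7)`; locally at `v ∣ 2` the partner's `2`-divisible group splits as `A[𝔭^∞] ⊕ A[𝔭̄^∞]`. -/
theorem neg_seven_mod_eight : ((-7 : ℤ) : ZMod 8) = 1 := by decide

/-- "At `2` every ordinary curve is anomalous": `#Ã(𝔽₂) = 2 + 1 − a₂` is even for odd `a₂`. -/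
theorem two_dvd_card_reduction_of_odd (a : ℤ) (ha : Odd a) : (2 : ℤ) ∣ 2 + 1 - a := by
  obtain ⟨k, rfl⟩ := ha
  exact ⟨1 - k, by ring⟩

/-- The two local values on the class: `a₂(A) = ±1` gives `#Ã(𝔽₂) ∈ {2, 4}` (the `[d′]₈` column
of the partner: `d′ ≡ 1 (8)` ↦ `a₂ = 1`, `d′ ≡ 5 (8)` ↦ `a₂ = −1`). -/
theorem card_reduction_two_cases (a : ℤ) (ha : a = 1 ∨ a = -1) :
    2 + 1 - a = 2 ∨ 2 + 1 - a = 4 := by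
  rcases ha with rfl | rfl <;> norm_num

/-! ## §B The twist on the module and on the characteristic series (proved)

A `Λ = ℤ₂⟦T⟧`-module is an abelian group with the action of `γ`; `T = γ − 1`. Twisting by a
character `χ` of `Γ` with `χ(γ) = −1` replaces `γ` by `−γ`, hence `T` by `−T − 2`. -/

section Module

variable {M : Type*} [AddCommGroup M]

/-- The twisted generator: `γ` acts on `M(χ)` as `χ(γ)·γ = −γ`. -/
def twistGen (g : M →+ M) : M →+ M := -g

/-- **`T_W = −(T_A + 2)`** as endomorphisms (`T = γ − 1`). -/
theorem twist_T (g : M →+ M) :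
    twistGen g - AddMonoidHom.id M = -((g - AddMonoidHom.id M) + 2 • AddMonoidHom.id M) := by
  ext m
  simp only [twistGen, AddMonoidHom.sub_apply, AddMonoidHom.neg_apply, AddMonoidHom.id_apply,
    AddMonoidHom.add_apply, two_nsmul]
  abel

/-- `Γ`-invariants of the twist = the "minus part": `(γ_W − 1) m = 0 ↔ γ_A m = −m`. -/
theorem twist_invariant_iff (g : M →+ M) (m : M) :
    (twistGen g - AddMonoidHom.id M) m = 0 ↔ g m = -m := by
  simp only [twistGen, AddMonoidHom.sub_apply, AddMonoidHom.neg_apply, AddMonoidHom.id_apply]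
  rw [sub_eq_zero, neg_eq_iff_eq_neg]

end Module

/-- The substitution `T ↦ −T − 2` evaluated at `T = 0`: **`f_W(0) = f_A(−2)`** (the value of the
partner's series at the character `χ_8`, `γ ↦ −1`). -/
theorem eval_zero_comp_twist (f : ℤ[X]) : (f.comp (-X - C 2)).eval 0 = f.eval (-2) := by
  simp [eval_comp]

/-- `T ↦ −T − 2` is an involution (so `char X_W = σ(char X_A)` whichever way one pulls back). -/
theorem comp_twist_comp_twist (f : ℤ[X]) : (f.comp (-X - C 2)).comp (-X - C 2) = f := by
  rw [comp_assoc]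
  have h : (-X - C 2 : ℤ[X]).comp (-X - C 2) = X := by
    simp only [sub_comp, neg_comp, X_comp, C_comp]
    ring
  rw [h, comp_X]

/-- **Same `λ`**: degrees of distinguished-polynomial representatives agree (contrast Greenberg,
LNM 1716 p. 159: at ODD `p` the `χ_8`-twist can change `λ` — `11a` vs `704a`). -/
theorem natDegree_comp_twist (f : ℤ[X]) : (f.comp (-X - C 2)).natDegree = f.natDegree := by
  rw [natDegree_comp, natDegree_sub_C, natDegree_neg, natDegree_X, mul_one]

/-- **Same `μ`** (and same first unit coefficient mod `2`): reduction mod `2` does not see the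
twist, `−T − 2 ≡ T (mod 2)`. -/
theorem map_modTwo_comp_twist (f : ℤ[X]) :
    (f.comp (-X - C 2)).map (Int.castRingHom (ZMod 2)) = f.map (Int.castRingHom (ZMod 2)) := by
  have hX : ((-X - C 2 : ℤ[X]).map (Int.castRingHom (ZMod 2))) = X := by
    have h2 : (Int.castRingHom (ZMod 2)) 2 = 0 := by decide
    rw [Polynomial.map_sub, Polynomial.map_neg, map_X, map_C, h2, map_zero, sub_zero]
    ext n
    simp [ZMod.neg_eq_self_mod_two]
  rw [map_comp, hX, comp_X]

/-! ## §C Bottom-layer digits: finite `Γ_v`-modules and the `Δ = ℤ/2` descent (proved) -/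

/-- **Herbrand quotient one on finite modules**: for an endomorphism `f` (= `γ_v − 1`) of a FINITE
abelian group, `#ker f = #coker f`, i.e. `#H⁰(Γ_v, M) = #H¹(Γ_v, M)` for a procyclic `Γ_v` acting on
a finite `M` through `γ_v` — the control-kernel digit `cΓ` read on either side (Greenberg, LNM 1716,
proof of Lemma 3.4 / Thm 4.1). -/
theorem natCard_ker_eq_natCard_coker {A : Type*} [AddCommGroup A] [Finite A] (f : A →+ A) :
    Nat.card f.ker = Nat.card (A ⧸ f.range) := by
  have h1 := AddSubgroup.card_eq_card_quotient_mul_card_addSubgroup f.ker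
  have h2 := AddSubgroup.card_eq_card_quotient_mul_card_addSubgroup f.range
  have h3 : Nat.card (A ⧸ f.ker) = Nat.card f.range :=
    Nat.card_congr (QuotientAddGroup.quotientKerEquivRange f).toEquiv
  have hpos : 0 < Nat.card f.range := Nat.card_pos
  rw [h3] at h1
  have key : Nat.card f.range * Nat.card f.ker = Nat.card f.range * Nat.card (A ⧸ f.range) := by
    rw [← h1, h2, mul_comm]
  exact Nat.eq_of_mul_eq_mul_left hpos key

/-- **External types, `Δ = Gal(L(√ε)/L) = ℤ/2`**: `Ĥ⁻¹(Δ, M)` is killed by `2` — if `m + σ m = 0`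
then `2m = (1 − σ) m` lies in the image of `1 − σ`. (Used for the `χ_ε`-isotypic comparison
`Sel(W/L_cyc) → Sel(A/L(√ε)_cyc)^{σ = −1}`: kernel and cokernel of exponent `2`, FINITE because
`W(L(√ε)_cyc)[2^∞]` is — the digit `cΔ`; `cΔ = 0` on the internal type.) -/
theorem two_nsmul_mem_range_of_add_eq_zero {A : Type*} [AddCommGroup A] (σ : A →+ A) (m : A)
    (hm : m + σ m = 0) : (2 : ℕ) • m ∈ (AddMonoidHom.id A - σ).range := by
  refine ⟨m, ?_⟩
  have hσ : σ m = -m := eq_neg_iff_add_eq_zero.mpr (by rwa [add_comm] at hm)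
  simp only [AddMonoidHom.sub_apply, AddMonoidHom.id_apply, hσ, sub_neg_eq_add, two_nsmul]

/-- … and `(1 + σ) ∘ (1 − σ) = 0` for an involution `σ`: the image of `1 − σ` sits in the
`σ = −1` part. -/
theorem norm_comp_oneSub_eq_zero {A : Type*} [AddCommGroup A] (σ : A →+ A)
    (hσ : σ.comp σ = AddMonoidHom.id A) :
    (AddMonoidHom.id A + σ).comp (AddMonoidHom.id A - σ) = 0 := by
  ext m
  have h := DFunLike.congr_fun hσ m
  simp only [AddMonoidHom.comp_apply, AddMonoidHom.id_apply] at h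
  simp only [AddMonoidHom.comp_apply, AddMonoidHom.sub_apply, AddMonoidHom.id_apply,
    AddMonoidHom.add_apply, map_sub, h, AddMonoidHom.zero_apply]
  abel

/-! ## §D The research statements, typed over tree declarations (`def … : Prop`; NOT asserted)

Vocabulary: `ZpExtension K 2`, `IsCyclotomic`, `IsTopGenerator`, `SelmerDualData` (`.X`,
`.charIdeal`), `IwasawaAlgebra 2 = ℤ₂⟦T⟧` (`Literature/…/IwasawaSelmer`, `…/IwasawaAlgebra`);
`localTowerKerPrimary` (`…/IwasawaSelmerControlLocalizationProofs`, Greenberg's `ker r_{v_n}`);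
`quadraticTwist` (`…/QuadraticTwist`); `HasGoodReductionAt`, `frobeniusTraceAt`,
`HasAdditiveReductionAt` as in `Greenberg1999.thm41_charValue_rankZero_numberField_anyPrime` /
`lemma33_natCard_localTowerKerPrimary_le_four_of_additive`. -/

/-- **H1 `TwistInTowerTwo` (internal type `ε = 2`; the twist is a character of `Γ`).** For
`W ≅ A^{(2)}` over a number field `K` and the cyclotomic `ℤ₂`-extension (which contains `√2`),
the Pontryagin duals of `Sel_{2^∞}(W/K_∞)` and `Sel_{2^∞}(A/K_∞)` are the SAME `ℤ₂`-module with
`T_W = −T_A − 2`. Source of the claim: `W ≅ A` over `K(√2) = K_1 ⊂ K_∞`, so the two Selmer groups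
over `K_∞` coincide as groups and the `Γ`-actions differ by `χ_8(γ) = −1` (Greenberg, LNM 1716,
pp. 124–125 "the exact sequence defining `Sel_E(F_∞)_p`, twisted by `κ^s`" — same mechanism for a
finite-order character of `Γ`; Greenberg–Vatsal 2000 §2). No parity input. -/
def TwistInTowerTwo : Prop :=
  ∀ (K : Type) [Field K] [NumberField K] (A W : WeierstrassCurve K) [A.IsElliptic] [W.IsElliptic],
    (∃ C : VariableChange K, C • A.quadraticTwist 2 = W) →
    ∀ (κ : ZpExtension K 2) (γ : Field.absoluteGaloisGroup K), κ.IsCyclotomic → κ.IsTopGenerator γ →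
    ∀ (DW : W.SelmerDualData κ γ) (DA : A.SelmerDualData κ γ),
      ∃ e : DW.X ≃+ DA.X,
        (∀ x : DW.X, e ((PowerSeries.X : IwasawaAlgebra 2) • x) =
            -((PowerSeries.X : IwasawaAlgebra 2) • e x) - 2 • e x) ∧
        (∀ (c : ℤ_[2]) (x : DW.X),
            e ((PowerSeries.C c : IwasawaAlgebra 2) • x) = (PowerSeries.C c : IwasawaAlgebra 2) • e x)

/-- **H2 `CharSeriesTwistTwo`** (consequence of H1 + the structure theorem): a polynomial generator
`f_A(T)` of `char X(A/K_∞)` gives the generator `f_A(−T − 2)` of `char X(W/K_∞)`. With §B: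
`λ(W) = λ(A)`, `μ(W) = μ(A)`, `f_W(0) = f_A(−2)`; torsion-ness and "no non-zero finite submodule"
transfer verbatim (same module). -/
def CharSeriesTwistTwo : Prop :=
  ∀ (K : Type) [Field K] [NumberField K] (A W : WeierstrassCurve K) [A.IsElliptic] [W.IsElliptic],
    (∃ C : VariableChange K, C • A.quadraticTwist 2 = W) →
    ∀ (κ : ZpExtension K 2) (γ : Field.absoluteGaloisGroup K), κ.IsCyclotomic → κ.IsTopGenerator γ →
    ∀ (DW : W.SelmerDualData κ γ) (DA : A.SelmerDualData κ γ) (fA : Polynomial ℤ_[2]),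
      DA.charIdeal = Ideal.span {((fA : PowerSeries ℤ_[2]) : IwasawaAlgebra 2)} →
      DW.charIdeal =
        Ideal.span {(((fA.comp (-Polynomial.X - Polynomial.C 2) : Polynomial ℤ_[2]) :
          PowerSeries ℤ_[2]) : IwasawaAlgebra 2)}

/-- **H3 `LocalTowerKerTwistedOrdinaryTwo`** — the bottom digit `cΓ`, UNIFORMLY IN THE TOWER
(this is exactly the negation of K4's recorded failure mode "not … uniformly in the tower"): at a
place `v ∣ 2` where the partner `A` is good ordinary and `W ≅ A^{(ε)}` is additive, Greenberg's
local restriction kernels `ker r_{v_n}` are finite of order bounded independently of `n` — because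
over `K_{v,∞}(√ε)` the curve IS `A`, whose `2`-power torsion in the local cyclotomic tower is finite
(Imai; tree `finite_torsion_cyclotomicZpExtension`), and `#H¹(Γ_{v_n}, finite) ≤ #(finite)`. The
`p = 2` form of the tree's T-T3B (`…Additive.GoodModelLine.localTowerKerPrimary_zero_eq_bot_of_goodOrd_twist`,
`p` odd, whose step `exists_mem_localSubgroup_ker_smul_sub_red_ne_zero` uses `p ≠ 2`: `−1` fixes
`2`-torsion), with `= ⊥` weakened to a bound (on the internal type the kernel is NOT expected to
vanish: `√2 ∈ K_{v,∞}`). -/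
def LocalTowerKerTwistedOrdinaryTwo : Prop :=
  ∀ (K : Type) [Field K] [NumberField K] (A W : WeierstrassCurve K) [A.IsElliptic] [W.IsElliptic]
    (ε : K), (ε = 2 ∨ ε = -1 ∨ ε = -2) → (∃ C : VariableChange K, C • A.quadraticTwist ε = W) →
    ∀ (v : HeightOneSpectrum (𝓞 K)), ((2 : ℕ) : 𝓞 K) ∈ v.asIdeal →
      A.HasGoodReductionAt v → ¬ (2 : ℤ) ∣ A.frobeniusTraceAt v → W.HasAdditiveReductionAt v →
      ∀ (κ : ZpExtension K 2), κ.IsCyclotomic →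
        ∃ B : ℕ, ∀ n : ℕ, Finite (W.localTowerKerPrimary κ (v.adicCompletion K) n) ∧
          Nat.card (W.localTowerKerPrimary κ (v.adicCompletion K) n) ≤ B

/-! ## §E K4′: the valuation shadow of road B⁻ with the twisted descent digit (proved glue)

k2-g5's chain (A) ∧ (MC⁻) ∧ (Desc⁻) ∧ (Pin) with `cdesc` REPLACED by `cΓ + cN + cΔ`:
`cΓ` = the control-kernel digit of H3 (finite `Γ_v`-cohomology of the twisted partner torsion,
§C), `cN` = the index of the `χ_ε`-twisted universal norms of the partner's height-one formal
group at the bottom layer, `cΔ` = the `Δ`-descent digit (§C; `0` on the internal type). -/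

/-- **`lower_of_roadBminus_twisted`.** -/
theorem lower_of_roadBminus_twisted (a2 r2 shaAn tam t f1 sha cΓ cN cΔ κ0 : ℤ)
    (hA : a2 - r2 = shaAn + tam - 2 * t + κ0)
    (hMC : a2 ≤ f1)
    (hDesc : f1 ≤ sha + tam - 2 * t + r2 + (cΓ + cN + cΔ))
    (hPin : cΓ + cN + cΔ ≤ κ0) :
    shaAn ≤ sha := by
  linarith

/-- Internal type: no `Δ`-descent. -/
theorem lower_of_roadBminus_twisted_internal (a2 r2 shaAn tam t f1 sha cΓ cN κ0 : ℤ)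
    (hA : a2 - r2 = shaAn + tam - 2 * t + κ0) (hMC : a2 ≤ f1)
    (hDesc : f1 ≤ sha + tam - 2 * t + r2 + (cΓ + cN)) (hPin : cΓ + cN ≤ κ0) :
    shaAn ≤ sha :=
  lower_of_roadBminus_twisted a2 r2 shaAn tam t f1 sha cΓ cN 0 κ0 hA hMC (by simpa using hDesc)
    (by simpa using hPin)

end Summit.BirchSwinnertonDyer.BirchSwinnertonDyer.Cruxes.SplitBadTwoLowerHalfOfFacts.StubIdeasK2G12

end
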